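import Literature.MathematicalPhysics.QuantumLattice.SectorSymbolMasterSmooth
import HarnessLib

/-!
# The master symbol: support box uniform in the scale parameter, and the scale reflection symmetry
(Benfatto–Giuliani–Mastropietro 2006, Lemma 2.2a: preparation)

Topic `Literature/MathematicalPhysics/QuantumLattice`; continues `SectorSymbolMasterSmooth.lean`,
where the support box `|t₀| ≤ e₀, |t₁| ≤ C₁, |t₂| ≤ C₂` of the rescaled symbol was obtained at
the dyadic values `s = 2^{-n}` of the scale parameter. Here the same box is PROVED for the master
symbol `Φ̂(θ₀, t; s)` at EVERY `s ∈ [0, 1]` (the sector geometry of BGM 2003 Lemma 7.3 with a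
continuous width parameter `w = πs`: on the support `|ε(k⃗) - μ| < e₀ s²`, `|Θ| < ¾πs`, whence
`|k'₁| ≤ C₁ s²`, `|k'₂| ≤ C₂ s`), together with the reflection symmetry
`Φ̂(θ₀, (t₀, t₁, -t₂); -s) = Φ̂(θ₀, (t₀, t₁, t₂); s)` (the chart point, `Ẽ` and `|Ã|` are
invariant; the angular profile is even). These are the two inputs of the improved bound
`|g^{(h)}_ω(0)| ≤ Cγ^{(5/2)h}` (Lemma 2.2a: `∫Φ̂(·; s) dt` is even in `s` and vanishes at `s = 0`).

* `abs_le_of_masterSymbol_ne_zero` — the uniform box for `0 < s ≤ 1`;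
* `abs_le_of_masterSymbol_ne_zero_of_mem_Icc` — the same for `s ∈ [0, 1]` (closure at `s = 0`);
* `sectorUnitWeight_neg` — the angular profile is even;
* `rescaledDispersion_reflect`, `rescaledAngle_reflect`, **`masterSymbol_reflect`**.

Everything is PROVED; no new definitions.

## Sources

* G. Benfatto, A. Giuliani, V. Mastropietro, Ann. Henri Poincaré 7 (2006) 809–898, §2.5 Lemma 2.2a
  (2.56a)–(2.56e) (arXiv:cond-mat/0507686 p. 11). [BenfattoGiulianiMastropietro2006]
* G. Benfatto, A. Giuliani, V. Mastropietro, Ann. Henri Poincaré 4 (2003) 137–193, §7.1 Lemmas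
  7.2–7.3. [BenfattoGiulianiMastropietro2003]
-/

noncomputable section

open Real Set Complex Function Metric Filter
open scoped Topology ComplexConjugate
open Literature.Analysis.Calculus Literature.Analysis.SpecialFunctions

namespace Literature.MathematicalPhysics.QuantumLattice

/-! ### The angular profile is even -/

/-- `b₁(-r) = b₁(r)`. [folklore] -/
theorem sectorProfile_neg (r : ℝ) : sectorProfile (-r) = sectorProfile r :=
  sectorProfile_neg_eq r

/-- `Σ_j b₁(-r - j) = Σ_j b₁(r - j)`. [folklore] -/
theorem sectorProfileSum_neg (r : ℝ) : sectorProfileSum (-r) = sectorProfileSum r := by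
  rw [sectorProfileSum, sectorProfileSum]
  rw [← (Equiv.neg ℤ).tsum_eq]
  refine tsum_congr fun j => ?_
  rw [Equiv.neg_apply, Int.cast_neg, show -r - -(j : ℝ) = -(r - j) by ring, sectorProfile_neg]

/-- **The angular profile is even**: `W(-r) = W(r)`. [folklore] -/
theorem sectorUnitWeight_neg (r : ℝ) : sectorUnitWeight (-r) = sectorUnitWeight r := by
  rw [sectorUnitWeight, sectorUnitWeight, sectorProfile_neg, sectorProfileSum_neg]

/-! ### The support box, uniformly in the scale parameter -/

section Box

variable {μ : ℝ} (hμ₁ : -4 < μ) (hμ₂ : μ < -2 - Real.sqrt 2)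
include hμ₁ hμ₂

omit hμ₁ hμ₂ in
/-- A continuous function of `s` which vanishes... agreement off `0` forces agreement at `0`. [folklore] -/
theorem ext_of_continuous_off_zero {f g : ℝ → ℝ} (hf : Continuous f) (hg : Continuous g) (h : ∀ s ≠ 0, f s = g s) : f = g :=
  hf.ext_on (dense_compl_singleton 0) hg fun s hs => h s hs

/-- **The uniform support box** (BGM 2003 Lemma 7.3 with continuous width `w = πs`): for
`0 < e₀ ≤ (4+μ)/2`, `0 < s ≤ 1`, if `Φ̂(θ₀, t₁, t₂; t₀; s) ≠ 0` then `|t₀| ≤ e₀`, `|t₁| ≤ C₁`, `|t₂| ≤ C₂`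
with the constants of `SectorSymbolMasterSmooth`. [cite: BenfattoGiulianiMastropietro2003, §7.1 Lemma 7.3] -/
theorem abs_le_of_masterSymbol_ne_zero {e₀ : ℝ} (he : 0 < e₀) (he' : e₀ ≤ (4 + μ) / 2) {θ₀ t₀ t₁ t₂ s : ℝ}
    (hs : 0 < s) (hs1 : s ≤ 1) (h : masterSymbol μ e₀ (θ₀, t₁, t₂) t₀ s ≠ 0) :
    |t₀| ≤ e₀ ∧ |t₁| ≤ normalExtentConst μ e₀ ∧ |t₂| ≤ tangentExtentConst μ e₀ := by
  set x : ℝ × ℝ × ℝ := (θ₀, t₁, t₂) with hx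
  set k : Fin 2 → ℝ := sectorChartPoint μ x s with hk
  set E : ℝ := rescaledDispersion μ (x, s) with hE
  set u : ℂ := sectorUFun μ x s with hu
  -- the nonvanishing factors
  rw [masterSymbol] at h
  have hG : gnShell 4 e₀ 0 (Real.sqrt (t₀ ^ 2 + E ^ 2)) ≠ 0 := by
    intro h0; apply h; rw [← hE, h0]; simp
  have hψ : truncOne (2 * truncRadius μ) (Real.cos (3 * π / 4)) (Real.cos (7 * π / 8)) u ≠ 0 := by
    intro h0; apply h; rw [← hu, h0]; simp
  have hW : sectorUnitWeight (rescaledAngle μ (x, s) / π) ≠ 0 := by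
    intro h0; apply h; rw [h0]; simp
  have hχ : zoneBump k ≠ 0 := by
    intro h0; apply h; rw [← hk, h0]; simp
  clear h
  -- (a) the shell: `|t₀| < e₀`, `|E| < e₀`
  have hmem := mem_Ioo_of_gnShell_zero_ne_zero he hG
  have hsq : t₀ ^ 2 + E ^ 2 < e₀ ^ 2 := by
    have h1 := hmem.2
    have h2 : Real.sqrt (t₀ ^ 2 + E ^ 2) ^ 2 < e₀ ^ 2 := by
      exact pow_lt_pow_left₀ h1 (Real.sqrt_nonneg _) two_ne_zero
    rwa [Real.sq_sqrt (by positivity)] at h2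
  have ht₀ : |t₀| ≤ e₀ := abs_le_of_sq_le_sq' (by nlinarith [sq_nonneg E]) he.le |> fun h => abs_le.2 h
  have hEabs : |E| < e₀ := abs_lt_of_sq_lt_sq' (by nlinarith [sq_nonneg t₀]) he.le |> fun h => abs_lt.2 h
  -- (b) the dispersion: `|ε(k) - μ| < e₀ s²`
  have hε : sqDispersion k - μ = s ^ 2 * E := sectorEpsFun_eq_sq_mul_rescaledDispersion hμ₁ hμ₂ x s
  have hs2 : s ^ 2 ≤ 1 := pow_le_one₀ hs.le hs1
  have hεabs : |sqDispersion k - μ| < e₀ * s ^ 2 := by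
    rw [hε, abs_mul, abs_of_pos (by positivity : 0 < s ^ 2), mul_comm]
    exact mul_lt_mul_of_pos_right hEabs (by positivity)
  have hεabs1 : |sqDispersion k - μ| < e₀ := hεabs.trans_le (by nlinarith)
  -- (c) the zone and the lower bound on `|k|`
  have hkπ : ‖momToComplex k‖ ≤ π / 2 := norm_le_of_zoneBump_ne_zero hχ
  set m₀ := Real.sqrt ((4 + μ) / 2) with hm₀
  have hm₀pos : 0 < m₀ := Real.sqrt_pos.2 (by linarith)
  have hρgt : m₀ < ‖momToComplex k‖ := by
    have h1 : 4 + μ - e₀ < ‖momToComplex k‖ ^ 2 := by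
      have := sqDispersion_le_norm_sq k
      have h2 := (abs_lt.1 hεabs1).1
      linarith
    have h2 : (4 + μ) / 2 ≤ 4 + μ - e₀ := by linarith
    calc m₀ = Real.sqrt ((4 + μ) / 2) := hm₀
      _ < Real.sqrt (‖momToComplex k‖ ^ 2) := Real.sqrt_lt_sqrt (by linarith) (by linarith)
      _ = ‖momToComplex k‖ := Real.sqrt_sq (norm_nonneg _)
  have hρpos : 0 < ‖momToComplex k‖ := hm₀pos.trans hρgt
  have hk0 : k ≠ 0 := by
    intro h0; rw [h0, (momToComplex_eq_zero_iff 0).2 rfl, norm_zero] at hρpos; exact lt_irrefl _ hρpos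
  -- (e) the relative angle: `|arg u| < ¾ π s`
  have hu0 : u ≠ 0 := by rw [hu, ← norm_pos_iff, norm_sectorUFun]; exact hρpos
  have hnu : 2 * truncRadius μ ≤ ‖u‖ := by rw [two_mul_truncRadius, hu, norm_sectorUFun]; exact hρgt.le
  have hru : truncRadius μ ≤ ‖u‖ := by linarith [truncRadius_pos hμ₁ (μ := μ)]
  have harg7 : |arg u| < 7 * π / 8 := by
    by_contra hle
    push Not at hle
    exact hψ (truncOne_eq_zero_of_le_abs_arg cos_seven_lt_cos_three (by positivity) le_rfl hu0 hle)
  have htr : truncArg (truncRadius μ) (Real.cos (7 * π / 8)) (Real.cos (15 * π / 16)) u = arg u :=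
    truncArg_eq_arg_of_abs_arg_le (truncRadius_pos hμ₁) cos_fifteen_lt_cos_seven (by linarith [pi_pos]) le_rfl hru harg7.le
  have hÃ : arg u = s * rescaledAngle μ (x, s) := by
    have h1 := sectorAngFun_eq_mul_rescaledAngle hμ₁ hμ₂ x s
    rw [sectorAngFun] at h1
    simp only at h1
    rw [← hu, htr] at h1
    exact h1
  have hargs : |arg u| < 3 / 4 * π * s := by
    have h1 : |rescaledAngle μ (x, s) / π| < 3 / 4 := by
      by_contra hle; push Not at hle; exact hW (sectorUnitWeight_eq_zero hle)
    rw [abs_div, abs_of_pos pi_pos, div_lt_iff₀ pi_pos] at h1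
    rw [hÃ, abs_mul, abs_of_pos hs]
    nlinarith
  -- (f) polar representation through `θ' = θ₀ + arg u`
  obtain ⟨j, hj⟩ := polarAngle_eq_add_sectorRelAngle θ₀ hk0
  have hrel : sectorRelAngle θ₀ k = arg u := by rw [hu, arg_sectorUFun]
  set θ' : ℝ := θ₀ + arg u with hθ'
  have hpol : polarAngle k - 2 * π * j = θ' := by rw [hj, hrel, hθ']; ring
  have hrepr : k = ‖momToComplex k‖ • dir θ' := by
    rw [← hpol, dir_sub_two_pi_mul]; exact polar_repr k
  have huθ : fermiRadius μ θ' = fermiRadius μ (polarAngle k) := by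
    rw [← hpol]; exact fermiRadius_sub_two_pi_mul hμ₁ hμ₂ _ _
  -- (g) radial deviation `|ρ - u(θ')| ≤ (π/(4m₀)) e₀ s²`
  have hdev := radial_deviation_le hμ₁ hμ₂ θ' hρpos hkπ
  rw [← hrepr] at hdev
  have huge : m₀ ≤ fermiRadius μ θ' := by
    rw [hm₀]
    calc Real.sqrt ((4 + μ) / 2) ≤ Real.sqrt (μ + 4) := Real.sqrt_le_sqrt (by linarith)
      _ ≤ fermiRadius μ θ' := sqrt_le_fermiRadius hμ₁ hμ₂ θ'
  have hmin : m₀ ≤ min ‖momToComplex k‖ (fermiRadius μ θ') := le_min hρgt.le huge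
  have hrad : |‖momToComplex k‖ - fermiRadius μ θ'| ≤ π / (4 * m₀) * (e₀ * s ^ 2) := by
    have h1 : 4 / π * m₀ * |‖momToComplex k‖ - fermiRadius μ θ'| ≤ e₀ * s ^ 2 :=
      le_trans (by gcongr) (hdev.trans hεabs.le)
    rw [div_mul_eq_mul_div, le_div_iff₀ (by positivity)]
    calc |‖momToComplex k‖ - fermiRadius μ θ'| * (4 * m₀) = π * (4 / π * m₀ * |‖momToComplex k‖ - fermiRadius μ θ'|) := by
          field_simp
      _ ≤ π * (e₀ * s ^ 2) := mul_le_mul_of_nonneg_left h1 pi_pos.le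
  -- (h) the normal coordinate `s² t₁`
  have hang : |θ' - θ₀| ≤ 3 / 4 * π * s := by
    rw [hθ', show θ₀ + arg u - θ₀ = arg u by ring]; exact hargs.le
  have hA0 : 0 ≤ accelBound μ := (abs_nonneg _).trans (abs_fermiAX_le hμ₁ hμ₂ 0)
  have hμ4 : 0 < μ + 4 := by linarith
  have hnc := abs_normalCoord_le hμ₁ hμ₂ θ₀ θ' ‖momToComplex k‖
  rw [← hrepr] at hnc
  have hncS : normalCoord μ θ₀ k = s ^ 2 * t₁ := by
    have := normalCoord_sectorChartPoint hμ₁ hμ₂ x s; simpa [hx] using this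
  have ht₁ : |t₁| ≤ normalExtentConst μ e₀ := by
    have hsq : (θ' - θ₀) ^ 2 ≤ (3 / 4 * π * s) ^ 2 := by
      rw [← sq_abs]; exact pow_le_pow_left₀ (abs_nonneg _) hang 2
    have hC : 0 ≤ 2 * accelBound μ * Real.sqrt (π ^ 2 / 8 + (4 * π ^ 3 / (μ + 4)) ^ 2) / Real.sqrt (μ + 4) := by positivity
    have h1 : |s ^ 2 * t₁| ≤ normalExtentConst μ e₀ * s ^ 2 := by
      rw [← hncS]
      calc _ ≤ _ := hnc
        _ ≤ π / (4 * m₀) * (e₀ * s ^ 2) +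
            2 * accelBound μ * Real.sqrt (π ^ 2 / 8 + (4 * π ^ 3 / (μ + 4)) ^ 2) / Real.sqrt (μ + 4) * (3 / 4 * π * s) ^ 2 :=
          add_le_add hrad (mul_le_mul_of_nonneg_left hsq hC)
        _ = normalExtentConst μ e₀ * s ^ 2 := by rw [normalExtentConst, hm₀]; ring
    rw [abs_mul, abs_of_pos (by positivity : 0 < s ^ 2), mul_comm] at h1
    exact le_of_mul_le_mul_right h1 (by positivity)
  -- (i) the tangential coordinate `s t₂`
  have htc := abs_tangentCoord_le hμ₁ hμ₂ θ₀ θ' ‖momToComplex k‖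
  rw [← hrepr] at htc
  have htcS : tangentCoord μ θ₀ k = s * t₂ := by
    have := tangentCoord_sectorChartPoint hμ₁ hμ₂ x s; simpa [hx] using this
  have ht₂ : |t₂| ≤ tangentExtentConst μ e₀ := by
    have hK : 0 ≤ 2 * Real.sqrt (π ^ 2 / 8 + (4 * π ^ 3 / (μ + 4)) ^ 2) := by positivity
    have hCr : 0 ≤ π / (4 * m₀) * e₀ := by positivity
    have h1 : |s * t₂| ≤ tangentExtentConst μ e₀ * s := by
      rw [← htcS]
      calc _ ≤ _ := htc
        _ ≤ π / (4 * m₀) * (e₀ * s ^ 2) + 2 * Real.sqrt (π ^ 2 / 8 + (4 * π ^ 3 / (μ + 4)) ^ 2) * (3 / 4 * π * s) :=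
          add_le_add hrad (mul_le_mul_of_nonneg_left hang hK)
        _ ≤ π / (4 * m₀) * (e₀ * s) + 2 * Real.sqrt (π ^ 2 / 8 + (4 * π ^ 3 / (μ + 4)) ^ 2) * (3 / 4 * π * s) := by
          have hss : s ^ 2 ≤ s := by rw [sq]; exact mul_le_of_le_one_left hs.le hs1
          have hC' : 0 ≤ π / (4 * m₀) := div_nonneg pi_pos.le (by positivity)
          exact add_le_add (mul_le_mul_of_nonneg_left (mul_le_mul_of_nonneg_left hss he.le) hC') le_rfl
        _ = tangentExtentConst μ e₀ * s := by rw [tangentExtentConst, hm₀]; ring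
    rw [abs_mul, abs_of_pos hs, mul_comm] at h1
    exact le_of_mul_le_mul_right h1 hs
  exact ⟨ht₀, ht₁, ht₂⟩

/-- **The box at every `s ∈ [0, 1]`** (at `s = 0` by continuity: a point with `Φ̂(·; 0) ≠ 0` has
`Φ̂(·; s) ≠ 0` for small `s > 0`). [cite: BenfattoGiulianiMastropietro2003, §7.1 Lemma 7.3] -/
theorem abs_le_of_masterSymbol_ne_zero_of_mem_Icc {e₀ : ℝ} (he : 0 < e₀) (he' : e₀ ≤ (4 + μ) / 2)
    {θ₀ t₀ t₁ t₂ s : ℝ} (hs : s ∈ Icc (0 : ℝ) 1) (h : masterSymbol μ e₀ (θ₀, t₁, t₂) t₀ s ≠ 0) :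
    |t₀| ≤ e₀ ∧ |t₁| ≤ normalExtentConst μ e₀ ∧ |t₂| ≤ tangentExtentConst μ e₀ := by
  rcases hs.1.eq_or_lt with h0 | hpos
  · -- `s = 0`: continuity in `s`
    subst h0
    set t : MomSpace := WithLp.toLp 2 ![t₀, t₁, t₂] with ht
    have hcont : Continuous fun s : ℝ => masterLift μ e₀ ((θ₀, s), t) :=
      (contDiff_masterLift hμ₁ hμ₂ he (μ := μ)).continuous.comp (by fun_prop)
    have hval : ∀ s, masterLift μ e₀ ((θ₀, s), t) = masterSymbol μ e₀ (θ₀, t₁, t₂) t₀ s := fun s => by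
      simp [masterLift, ht]
    have hne : ∀ᶠ s in 𝓝 (0 : ℝ), masterLift μ e₀ ((θ₀, s), t) ≠ 0 := by
      refine (hcont.continuousAt (x := 0)).eventually_ne ?_
      rwa [hval]
    have hne' : ∀ᶠ s in 𝓝[>] (0 : ℝ), masterLift μ e₀ ((θ₀, s), t) ≠ 0 ∧ s ∈ Ioo (0 : ℝ) 1 :=
      (hne.filter_mono nhdsWithin_le_nhds).and (Ioo_mem_nhdsGT one_pos)
    obtain ⟨s, hs, hsI⟩ := hne'.exists
    rw [hval] at hs
    exact abs_le_of_masterSymbol_ne_zero hμ₁ hμ₂ he he' hsI.1 hsI.2.le hs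
  · exact abs_le_of_masterSymbol_ne_zero hμ₁ hμ₂ he he' hpos hs.2 h

end Box

/-! ### The reflection symmetry `(s, t₂) ↦ (-s, -t₂)` -/

section Reflect

variable {μ : ℝ} (hμ₁ : -4 < μ) (hμ₂ : μ < -2 - Real.sqrt 2)
include hμ₁ hμ₂

omit hμ₁ hμ₂ in
/-- The chart point is invariant. [folklore] -/
theorem sectorChartPoint_reflect (μ θ₀ t₁ t₂ s : ℝ) :
    sectorChartPoint μ (θ₀, t₁, -t₂) (-s) = sectorChartPoint μ (θ₀, t₁, t₂) s := by
  ext i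
  fin_cases i
  · simp only [Fin.zero_eta, Fin.isValue, sectorChartPoint_apply_zero]; ring
  · simp only [Fin.mk_one, Fin.isValue, sectorChartPoint_apply_one]; ring

omit hμ₁ hμ₂ in
/-- `u` is invariant. [folklore] -/
theorem sectorUFun_reflect (μ θ₀ t₁ t₂ s : ℝ) : sectorUFun μ (θ₀, t₁, -t₂) (-s) = sectorUFun μ (θ₀, t₁, t₂) s := by
  rw [sectorUFun, sectorUFun, sectorChartPoint_reflect]

/-- **`Ẽ` is invariant** (`s²Ẽ = ε(k) - μ` on both sides; at `s = 0` by continuity). [folklore] -/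
theorem rescaledDispersion_reflect (θ₀ t₁ t₂ s : ℝ) :
    rescaledDispersion μ ((θ₀, t₁, -t₂), -s) = rescaledDispersion μ ((θ₀, t₁, t₂), s) := by
  have hcont := (contDiff_rescaledDispersion hμ₁ hμ₂ (μ := μ)).continuous
  have h1 : Continuous fun s : ℝ => rescaledDispersion μ ((θ₀, t₁, -t₂), -s) := hcont.comp (by fun_prop)
  have h2 : Continuous fun s : ℝ => rescaledDispersion μ ((θ₀, t₁, t₂), s) := hcont.comp (by fun_prop)
  have key := ext_of_continuous_off_zero h1 h2 fun s hs => by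
    have ha := sectorEpsFun_eq_sq_mul_rescaledDispersion hμ₁ hμ₂ (θ₀, t₁, -t₂) (-s)
    have hb := sectorEpsFun_eq_sq_mul_rescaledDispersion hμ₁ hμ₂ (θ₀, t₁, t₂) s
    have hab : sectorEpsFun μ ((θ₀, t₁, -t₂), -s) = sectorEpsFun μ ((θ₀, t₁, t₂), s) := by
      simp only [sectorEpsFun, sectorChartPoint_reflect]
    rw [hab, hb, neg_sq] at ha
    exact (mul_left_cancel₀ (pow_ne_zero 2 hs) ha).symm
  exact congr_fun key s

/-- **`Ã` is odd** (`sÃ = truncArg(u)` on both sides; at `s = 0` by continuity). [folklore] -/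
theorem rescaledAngle_reflect (θ₀ t₁ t₂ s : ℝ) :
    rescaledAngle μ ((θ₀, t₁, -t₂), -s) = -rescaledAngle μ ((θ₀, t₁, t₂), s) := by
  have hcont := (contDiff_rescaledAngle hμ₁ hμ₂ (μ := μ)).continuous
  have h1 : Continuous fun s : ℝ => rescaledAngle μ ((θ₀, t₁, -t₂), -s) := hcont.comp (by fun_prop)
  have h2 : Continuous fun s : ℝ => -rescaledAngle μ ((θ₀, t₁, t₂), s) := (hcont.comp (by fun_prop)).neg
  have key := ext_of_continuous_off_zero h1 h2 fun s hs => by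
    have ha := sectorAngFun_eq_mul_rescaledAngle hμ₁ hμ₂ (θ₀, t₁, -t₂) (-s)
    have hb := sectorAngFun_eq_mul_rescaledAngle hμ₁ hμ₂ (θ₀, t₁, t₂) s
    have hab : sectorAngFun μ ((θ₀, t₁, -t₂), -s) = sectorAngFun μ ((θ₀, t₁, t₂), s) := by
      simp only [sectorAngFun, sectorUFun_reflect]
    rw [hab, hb] at ha
    have : s * rescaledAngle μ ((θ₀, t₁, t₂), s) = s * -rescaledAngle μ ((θ₀, t₁, -t₂), -s) := by linear_combination ha
    have := mul_left_cancel₀ hs this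
    linarith
  exact congr_fun key s

/-- **The reflection symmetry of the master symbol**: `Φ̂(θ₀, t₁, -t₂; t₀; -s) = Φ̂(θ₀, t₁, t₂; t₀; s)`. [cite: BenfattoGiulianiMastropietro2006, §2.5 Lemma 2.2a] -/
theorem masterSymbol_reflect (e₀ θ₀ t₀ t₁ t₂ s : ℝ) :
    masterSymbol μ e₀ (θ₀, t₁, -t₂) t₀ (-s) = masterSymbol μ e₀ (θ₀, t₁, t₂) t₀ s := by
  simp only [masterSymbol, rescaledDenom, rescaledDispersion_reflect hμ₁ hμ₂, rescaledAngle_reflect hμ₁ hμ₂,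
    sectorUFun_reflect, sectorChartPoint_reflect, neg_div, sectorUnitWeight_neg]

/-- The same for the lift: `Φ̂((θ₀, -s), (t₀, t₁, -t₂)) = Φ̂((θ₀, s), t)`. [folklore] -/
theorem masterLift_reflect (e₀ θ₀ s : ℝ) (t : MomSpace) :
    masterLift μ e₀ ((θ₀, -s), WithLp.toLp 2 ![t 0, t 1, -t 2]) = masterLift μ e₀ ((θ₀, s), t) := by
  simp only [masterLift, Matrix.cons_val_zero, Matrix.cons_val_one, Matrix.cons_val_two,
    Matrix.tail_cons, Matrix.head_cons]
  exact masterSymbol_reflect hμ₁ hμ₂ e₀ θ₀ (t 0) (t 1) (t 2) s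

end Reflect

end Literature.MathematicalPhysics.QuantumLattice

end
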